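import Mathlib
import Summits.KontsevichZagierPeriods.Zeta5Search.DenomLaw.ThresholdScoreFour

/-!
# ζ(5) search — DENOM-LAW D1: ONE dominant root type on eleven «−1» digit types (the hypothesis of the Lemma-D bonus in the threshold model)

Cell `pub-zeta5`, track DENOM-LAW (denom-prover-d1 g7, 2026-08-24; ATTEMPT-8 §5).  HONEST FRAMING: systematic search; MODEL/structure side —
elementary order-statistic bookkeeping in the threshold model (`L`, `R`, `n₊`, `n₋` of Part I) on sorted block coordinates `ρ`; nothing
about ζ(5); no γ; no p-adic digit, no linear form, no kernel value; no irrationality claim; records in print UNMOVED.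

## What is proved (kernel-checked), for sorted `ρ` (`r 0 ≤ … ≤ r 6`), 0-based block indices
* FACTS (each a disjunction of two count inequalities, for every `u`): a low pair `(0,k)` / `(1,k)` gives `R ≥ 1 ∨ L ≥ k+1` /
  `R ≥ 2 ∨ L ≥ k+1` (`fact_low0`, `fact_low1`); a looped block `0` / `1` gives `R ≥ 1 ∨ n₊ = 1` / `R ≥ 2 ∨ n₊ = 1` (`fact_loop0`,
  `fact_loop1`); a looped block `k` gives `L ≥ k+1 ∨ n₋ = 1` (`fact_loopL`); no looped block gives `n₊ = 0 ∨ R = 0` (`fact_a0`).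
* **ROOT TYPES** (`rootType_…`): on each of the eleven digit types a=0 λ=(1), (2,1), (3,2), (4,1); a=1 ∅, (3,1); a=2 (1), (2,1), (3);
  a=3 (2); a=4 (1) (1-based λ; «looped» = `b_j ≥ p` = `ρ ≤ R₀ − p`, «low» = pair block below `p` = `ρ_j + ρ_k < 2p`), every class
  `0 < u < p` of the minimal score `s₀` (= 2, 3, 4, 4, 2, 4, 3, 4, 4, 4, 4) is either SYMMETRIC (`L = R`, `n₊ = n₋`) or has THE root type
  `(n₋, L, R, n₊)` = (0,2,0,0), (0,3,0,0), (0,4,0,0), (0,3,1,0), (0,1,0,1), (0,3,1,0), (0,2,0,1), (0,3,0,1), (0,2,1,1), (0,3,0,1), (1,2,0,1)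
  respectively — so, up to the mirror `u ↦ −u` (which reverses the type) and the dropped symmetric classes, the dominant classes of such
  a cell have ONE exponent type: the hypothesis of gen-2 g8's LEMMA D (`RuleR2LemmaD.lemmaD_of_rootType`).
* `five_le_score_zero_l21`, `five_le_score_zero_a2l1`: on the two types with `s₀ = 3` the centre class scores `≥ 5`.
Numerical companion (model side, exhaustive over all sorted parity-correct `ρ` in the box, `p = 11`, `code/k2/lemmaDcheck.py` of the seat
folder): one root type per configuration on all eleven types (7,530 / 6,690 / 3,258 / 1,500 / 4,170 / 1,056 / 5,010 / 2,370 / 1,284 / 1,974 / 840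
configurations), 0 exceptions; the three remaining «−1» types a=0 (3), a=1 (2), a=3 ∅ FAIL it where the centre class is dominant.
-/

namespace Summit.KontsevichZagierPeriods.Zeta5Search.DenomLaw.ThresholdModel.Rho

section RootTypes
variable {p R0 : ℤ} {r : Fin 7 → ℤ}

/-! ### facts -/

/-- a low pair `(0,k)`: `R ≥ 1` or `L ≥ k + 1` (if `ρ₁ ≥ p − u` then `ρ_k < 2p − ρ₁ ≤ p + u`). -/
theorem fact_low0 (hr : Monotone r) (k : Fin 7) (hlow : r 0 + r k < 2 * p) (u : ℤ) :
    1 ≤ R p r u ∨ (k : ℤ) + 1 ≤ L p r u := by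
  by_cases h : r 0 < p - u
  · left; have := countLt_ge hr 0 h; simp at this; unfold R; linarith
  · right; unfold L; exact countLt_ge hr k (by linarith)

/-- a low pair `(1,k)`: `R ≥ 2` or `L ≥ k + 1`. -/
theorem fact_low1 (hr : Monotone r) (k : Fin 7) (hlow : r 1 + r k < 2 * p) (u : ℤ) :
    2 ≤ R p r u ∨ (k : ℤ) + 1 ≤ L p r u := by
  have e1 : (((1 : Fin 7) : ℕ) : ℤ) = 1 := by decide
  by_cases h : r 1 < p - u
  · left; have := countLt_ge hr 1 h; rw [e1] at this; unfold R; linarith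
  · right; unfold L; exact countLt_ge hr k (by linarith)

/-- a looped block `0` (`ρ₁ ≤ R₀ − p`): `R ≥ 1` or `n₊ = 1` (if `ρ₁ ≥ p − u` then `u ≥ p − ρ₁ ≥ 2p − R₀`). -/
theorem fact_loop0 (hr : Monotone r) (h0 : r 0 ≤ R0 - p) (u : ℤ) : 1 ≤ R p r u ∨ np p R0 u = 1 := by
  by_cases h : r 0 < p - u
  · left; have := countLt_ge hr 0 h; simp at this; unfold R; linarith
  · right; exact indic_pos (by linarith)

/-- a looped block `1` (`ρ₂ ≤ R₀ − p`): `R ≥ 2` or `n₊ = 1`. -/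
theorem fact_loop1 (hr : Monotone r) (h1 : r 1 ≤ R0 - p) (u : ℤ) : 2 ≤ R p r u ∨ np p R0 u = 1 := by
  have e1 : (((1 : Fin 7) : ℕ) : ℤ) = 1 := by decide
  by_cases h : r 1 < p - u
  · left; have := countLt_ge hr 1 h; rw [e1] at this; unfold R; linarith
  · right; exact indic_pos (by linarith)

/-- a looped block `k` (`ρ_{k+1} ≤ R₀ − p`): `L ≥ k + 1` or `n₋ = 1` (if `ρ_{k+1} ≥ p + u` then `u ≤ ρ_{k+1} − p ≤ R₀ − 2p`). -/
theorem fact_loopL (hr : Monotone r) (k : Fin 7) (hk : r k ≤ R0 - p) (u : ℤ) :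
    (k : ℤ) + 1 ≤ L p r u ∨ nm p R0 u = 1 := by
  by_cases h : r k < u + p
  · left; unfold L; exact countLt_ge hr k h
  · right; exact indic_pos (by linarith)

/-- no looped block (`R₀ − p < ρ₁`): `n₊ = 0` or `R = 0` (if `u ≥ 2p − R₀ > p − ρ₁` then no block lies below `p − u`). -/
theorem fact_a0 (hr : Monotone r) (h0 : R0 - p < r 0) (u : ℤ) : np p R0 u = 0 ∨ R p r u ≤ 0 := by
  by_cases h : 2 * p - R0 ≤ u
  · right
    have := countLt_le hr 0 (T := p - u) (by linarith)
    simp at this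
    unfold R; linarith
  · left; exact indic_neg h

/-! ### the eleven root types (`0 < u < p`, score `= s₀`: symmetric or THE type) -/

/-- a=0, λ=(1): pair `(0,1)` low; `s₀ = 2`; type `(0,2,0,0)`. -/
theorem rootType_l1 (hr : Monotone r) (h01 : r 0 + r 1 < 2 * p) {u : ℤ} (hu : 0 < u) (hup : u < p)
    (hsc : score p R0 r u = 2) :
    (nm p R0 u = 0 ∧ L p r u = 2 ∧ R p r u = 0 ∧ np p R0 u = 0) ∨ (L p r u = R p r u ∧ np p R0 u = nm p R0 u) := by
  have e1 : (((1 : Fin 7) : ℕ) : ℤ) = 1 := by decide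
  have hRL := R_le_L p r hu
  have hnn := nm_le_np p R0 hu
  have cR := countLt_nonneg r (p - u)
  have i1 := indic_le_one (2 * p - R0 ≤ u)
  have i2 := indic_nonneg (u ≤ R0 - 2 * p)
  have hc : centre p u = 0 := indic_neg (by rintro (h | h) <;> omega)
  have f1 := fact_low0 hr 1 h01 u; rw [e1] at f1
  unfold score delta at hsc
  rw [hc] at hsc
  unfold L R np nm at *
  omega

/-- a=0, λ=(2,1): pairs `(0,1)`, `(0,2)`, `(1,2)` low, no looped block; `s₀ = 3`; type `(0,3,0,0)`. -/
theorem rootType_l21 (hr : Monotone r) (ha : R0 - p < r 0) (h01 : r 0 + r 1 < 2 * p) (h02 : r 0 + r 2 < 2 * p)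
    (h12 : r 1 + r 2 < 2 * p) {u : ℤ} (hu : 0 < u) (hup : u < p) (hsc : score p R0 r u = 3) :
    (nm p R0 u = 0 ∧ L p r u = 3 ∧ R p r u = 0 ∧ np p R0 u = 0) ∨ (L p r u = R p r u ∧ np p R0 u = nm p R0 u) := by
  have e1 : (((1 : Fin 7) : ℕ) : ℤ) = 1 := by decide
  have e2 : (((2 : Fin 7) : ℕ) : ℤ) = 2 := by decide
  have hRL := R_le_L p r hu
  have hnn := nm_le_np p R0 hu
  have cR := countLt_nonneg r (p - u)
  have i1 := indic_le_one (2 * p - R0 ≤ u)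
  have i2 := indic_nonneg (u ≤ R0 - 2 * p)
  have hc : centre p u = 0 := indic_neg (by rintro (h | h) <;> omega)
  have f1 := fact_low0 hr 1 h01 u; rw [e1] at f1
  have f2 := fact_low0 hr 2 h02 u; rw [e2] at f2
  have f3 := fact_low1 hr 2 h12 u; rw [e2] at f3
  have f4 := fact_a0 hr ha u
  unfold score delta at hsc
  rw [hc] at hsc
  unfold L R np nm at *
  omega

/-- a=0, λ=(3,2): pairs `(0,2)`, `(0,3)`, `(1,2)`, `(1,3)` low; `s₀ = 4`; type `(0,4,0,0)`. -/
theorem rootType_l32 (hr : Monotone r) (h02 : r 0 + r 2 < 2 * p) (h03 : r 0 + r 3 < 2 * p) (h12 : r 1 + r 2 < 2 * p)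
    (h13 : r 1 + r 3 < 2 * p) {u : ℤ} (hu : 0 < u) (hup : u < p) (hsc : score p R0 r u = 4) :
    (nm p R0 u = 0 ∧ L p r u = 4 ∧ R p r u = 0 ∧ np p R0 u = 0) ∨ (L p r u = R p r u ∧ np p R0 u = nm p R0 u) := by
  have e2 : (((2 : Fin 7) : ℕ) : ℤ) = 2 := by decide
  have e3 : (((3 : Fin 7) : ℕ) : ℤ) = 3 := by decide
  have hRL := R_le_L p r hu
  have hnn := nm_le_np p R0 hu
  have cR := countLt_nonneg r (p - u)
  have i1 := indic_le_one (2 * p - R0 ≤ u)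
  have i2 := indic_nonneg (u ≤ R0 - 2 * p)
  have hc : centre p u = 0 := indic_neg (by rintro (h | h) <;> omega)
  have f1 := fact_low0 hr 2 h02 u; rw [e2] at f1
  have f2 := fact_low0 hr 3 h03 u; rw [e3] at f2
  have f3 := fact_low1 hr 2 h12 u; rw [e2] at f3
  have f4 := fact_low1 hr 3 h13 u; rw [e3] at f4
  unfold score delta at hsc
  rw [hc] at hsc
  unfold L R np nm at *
  omega

/-- a=0, λ=(4,1): pairs `(0,2)`, `(0,3)`, `(0,4)`, `(1,2)` low; `s₀ = 4`; type `(0,3,1,0)`. -/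
theorem rootType_l41 (hr : Monotone r) (h02 : r 0 + r 2 < 2 * p) (h03 : r 0 + r 3 < 2 * p) (h04 : r 0 + r 4 < 2 * p)
    (h12 : r 1 + r 2 < 2 * p) {u : ℤ} (hu : 0 < u) (hup : u < p) (hsc : score p R0 r u = 4) :
    (nm p R0 u = 0 ∧ L p r u = 3 ∧ R p r u = 1 ∧ np p R0 u = 0) ∨ (L p r u = R p r u ∧ np p R0 u = nm p R0 u) := by
  have e2 : (((2 : Fin 7) : ℕ) : ℤ) = 2 := by decide
  have e3 : (((3 : Fin 7) : ℕ) : ℤ) = 3 := by decide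
  have e4 : (((4 : Fin 7) : ℕ) : ℤ) = 4 := by decide
  have hRL := R_le_L p r hu
  have hnn := nm_le_np p R0 hu
  have cR := countLt_nonneg r (p - u)
  have i1 := indic_le_one (2 * p - R0 ≤ u)
  have i2 := indic_nonneg (u ≤ R0 - 2 * p)
  have hc : centre p u = 0 := indic_neg (by rintro (h | h) <;> omega)
  have f1 := fact_low0 hr 2 h02 u; rw [e2] at f1
  have f2 := fact_low0 hr 3 h03 u; rw [e3] at f2
  have f3 := fact_low0 hr 4 h04 u; rw [e4] at f3
  have f4 := fact_low1 hr 2 h12 u; rw [e2] at f4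
  unfold score delta at hsc
  rw [hc] at hsc
  unfold L R np nm at *
  omega

/-- a=1, λ=∅: block `0` looped; `s₀ = 2`; type `(0,1,0,1)`. -/
theorem rootType_a1l0 (hr : Monotone r) (hl0 : r 0 ≤ R0 - p) {u : ℤ} (hu : 0 < u) (hup : u < p)
    (hsc : score p R0 r u = 2) :
    (nm p R0 u = 0 ∧ L p r u = 1 ∧ R p r u = 0 ∧ np p R0 u = 1) ∨ (L p r u = R p r u ∧ np p R0 u = nm p R0 u) := by
  have hRL := R_le_L p r hu
  have hnn := nm_le_np p R0 hu
  have cR := countLt_nonneg r (p - u)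
  have i1 := indic_le_one (2 * p - R0 ≤ u)
  have i2 := indic_nonneg (u ≤ R0 - 2 * p)
  have hc : centre p u = 0 := indic_neg (by rintro (h | h) <;> omega)
  have f1 := fact_loop0 hr hl0 u
  unfold score delta at hsc
  rw [hc] at hsc
  unfold L R np nm at *
  omega

/-- a=1, λ=(3,1): block `0` looped, pairs `(0,2)`, `(0,3)`, `(1,2)` low; `s₀ = 4`; type `(0,3,1,0)`. -/
theorem rootType_a1l31 (hr : Monotone r) (hl0 : r 0 ≤ R0 - p) (h02 : r 0 + r 2 < 2 * p) (h03 : r 0 + r 3 < 2 * p)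
    (h12 : r 1 + r 2 < 2 * p) {u : ℤ} (hu : 0 < u) (hup : u < p) (hsc : score p R0 r u = 4) :
    (nm p R0 u = 0 ∧ L p r u = 3 ∧ R p r u = 1 ∧ np p R0 u = 0) ∨ (L p r u = R p r u ∧ np p R0 u = nm p R0 u) := by
  have e2 : (((2 : Fin 7) : ℕ) : ℤ) = 2 := by decide
  have e3 : (((3 : Fin 7) : ℕ) : ℤ) = 3 := by decide
  have hRL := R_le_L p r hu
  have hnn := nm_le_np p R0 hu
  have cR := countLt_nonneg r (p - u)
  have i1 := indic_le_one (2 * p - R0 ≤ u)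
  have i2 := indic_nonneg (u ≤ R0 - 2 * p)
  have hc : centre p u = 0 := indic_neg (by rintro (h | h) <;> omega)
  have f1 := fact_loop0 hr hl0 u
  have f2 := fact_low0 hr 2 h02 u; rw [e2] at f2
  have f3 := fact_low0 hr 3 h03 u; rw [e3] at f3
  have f4 := fact_low1 hr 2 h12 u; rw [e2] at f4
  unfold score delta at hsc
  rw [hc] at hsc
  unfold L R np nm at *
  omega

/-- a=2, λ=(1): blocks `0, 1` looped, pair `(0,1)` low; `s₀ = 3`; type `(0,2,0,1)`. -/
theorem rootType_a2l1 (hr : Monotone r) (hl1 : r 1 ≤ R0 - p) (h01 : r 0 + r 1 < 2 * p) {u : ℤ} (hu : 0 < u) (hup : u < p)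
    (hsc : score p R0 r u = 3) :
    (nm p R0 u = 0 ∧ L p r u = 2 ∧ R p r u = 0 ∧ np p R0 u = 1) ∨ (L p r u = R p r u ∧ np p R0 u = nm p R0 u) := by
  have e1 : (((1 : Fin 7) : ℕ) : ℤ) = 1 := by decide
  have m01 : r 0 ≤ r 1 := hr (by decide)
  have hRL := R_le_L p r hu
  have hnn := nm_le_np p R0 hu
  have cR := countLt_nonneg r (p - u)
  have i1 := indic_le_one (2 * p - R0 ≤ u)
  have i2 := indic_nonneg (u ≤ R0 - 2 * p)
  have i3 := indic_le_one (u ≤ R0 - 2 * p)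
  have hc : centre p u = 0 := indic_neg (by rintro (h | h) <;> omega)
  have f1 := fact_loop0 hr (le_trans m01 hl1) u
  have f2 := fact_loop1 hr hl1 u
  have f3 := fact_loopL hr 1 hl1 u; rw [e1] at f3
  have f4 := fact_low0 hr 1 h01 u; rw [e1] at f4
  unfold score delta at hsc
  rw [hc] at hsc
  unfold L R np nm at *
  omega

/-- a=2, λ=(2,1): blocks `0, 1` looped, pairs `(0,2)`, `(1,2)` low; `s₀ = 4`; type `(0,3,0,1)`. -/
theorem rootType_a2l21 (hr : Monotone r) (hl1 : r 1 ≤ R0 - p) (h02 : r 0 + r 2 < 2 * p) (h12 : r 1 + r 2 < 2 * p)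
    {u : ℤ} (hu : 0 < u) (hup : u < p) (hsc : score p R0 r u = 4) :
    (nm p R0 u = 0 ∧ L p r u = 3 ∧ R p r u = 0 ∧ np p R0 u = 1) ∨ (L p r u = R p r u ∧ np p R0 u = nm p R0 u) := by
  have e2 : (((2 : Fin 7) : ℕ) : ℤ) = 2 := by decide
  have m01 : r 0 ≤ r 1 := hr (by decide)
  have hRL := R_le_L p r hu
  have hnn := nm_le_np p R0 hu
  have cR := countLt_nonneg r (p - u)
  have i1 := indic_le_one (2 * p - R0 ≤ u)
  have i2 := indic_nonneg (u ≤ R0 - 2 * p)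
  have hc : centre p u = 0 := indic_neg (by rintro (h | h) <;> omega)
  have f1 := fact_loop0 hr (le_trans m01 hl1) u
  have f2 := fact_loop1 hr hl1 u
  have f3 := fact_low0 hr 2 h02 u; rw [e2] at f3
  have f4 := fact_low1 hr 2 h12 u; rw [e2] at f4
  unfold score delta at hsc
  rw [hc] at hsc
  unfold L R np nm at *
  omega

/-- a=2, λ=(3): blocks `0, 1` looped, pairs `(0,2)`, `(0,3)` low; `s₀ = 4`; type `(0,2,1,1)`. -/
theorem rootType_a2l3 (hr : Monotone r) (hl1 : r 1 ≤ R0 - p) (h02 : r 0 + r 2 < 2 * p) (h03 : r 0 + r 3 < 2 * p)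
    {u : ℤ} (hu : 0 < u) (hup : u < p) (hsc : score p R0 r u = 4) :
    (nm p R0 u = 0 ∧ L p r u = 2 ∧ R p r u = 1 ∧ np p R0 u = 1) ∨ (L p r u = R p r u ∧ np p R0 u = nm p R0 u) := by
  have e2 : (((2 : Fin 7) : ℕ) : ℤ) = 2 := by decide
  have e3 : (((3 : Fin 7) : ℕ) : ℤ) = 3 := by decide
  have m01 : r 0 ≤ r 1 := hr (by decide)
  have hRL := R_le_L p r hu
  have hnn := nm_le_np p R0 hu
  have cR := countLt_nonneg r (p - u)
  have i1 := indic_le_one (2 * p - R0 ≤ u)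
  have i2 := indic_nonneg (u ≤ R0 - 2 * p)
  have hc : centre p u = 0 := indic_neg (by rintro (h | h) <;> omega)
  have f1 := fact_loop0 hr (le_trans m01 hl1) u
  have f2 := fact_loop1 hr hl1 u
  have f3 := fact_low0 hr 2 h02 u; rw [e2] at f3
  have f4 := fact_low0 hr 3 h03 u; rw [e3] at f4
  unfold score delta at hsc
  rw [hc] at hsc
  unfold L R np nm at *
  omega

/-- a=3, λ=(2): blocks `0, 1, 2` looped, pair `(0,2)` low; `s₀ = 4`; type `(0,3,0,1)`. -/
theorem rootType_a3l2 (hr : Monotone r) (hl2 : r 2 ≤ R0 - p) (h02 : r 0 + r 2 < 2 * p) {u : ℤ} (hu : 0 < u)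
    (hup : u < p) (hsc : score p R0 r u = 4) :
    (nm p R0 u = 0 ∧ L p r u = 3 ∧ R p r u = 0 ∧ np p R0 u = 1) ∨ (L p r u = R p r u ∧ np p R0 u = nm p R0 u) := by
  have e2 : (((2 : Fin 7) : ℕ) : ℤ) = 2 := by decide
  have m01 : r 0 ≤ r 1 := hr (by decide)
  have m12 : r 1 ≤ r 2 := hr (by decide)
  have hRL := R_le_L p r hu
  have hnn := nm_le_np p R0 hu
  have cR := countLt_nonneg r (p - u)
  have i1 := indic_le_one (2 * p - R0 ≤ u)
  have i2 := indic_nonneg (u ≤ R0 - 2 * p)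
  have i3 := indic_le_one (u ≤ R0 - 2 * p)
  have hc : centre p u = 0 := indic_neg (by rintro (h | h) <;> omega)
  have f1 := fact_loop0 hr (le_trans m01 (le_trans m12 hl2)) u
  have f2 := fact_loop1 hr (le_trans m12 hl2) u
  have f3 := fact_loopL hr 2 hl2 u; rw [e2] at f3
  have f4 := fact_low0 hr 2 h02 u; rw [e2] at f4
  unfold score delta at hsc
  rw [hc] at hsc
  unfold L R np nm at *
  omega

/-- a=4, λ=(1): blocks `0, …, 3` looped (the low pair `(0,1)` is not even needed); `s₀ = 4`; type `(1,2,0,1)`. -/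
theorem rootType_a4l1 (hr : Monotone r) (hl3 : r 3 ≤ R0 - p) {u : ℤ} (hu : 0 < u)
    (hup : u < p) (hsc : score p R0 r u = 4) :
    (nm p R0 u = 1 ∧ L p r u = 2 ∧ R p r u = 0 ∧ np p R0 u = 1) ∨ (L p r u = R p r u ∧ np p R0 u = nm p R0 u) := by
  have e2 : (((2 : Fin 7) : ℕ) : ℤ) = 2 := by decide
  have e3 : (((3 : Fin 7) : ℕ) : ℤ) = 3 := by decide
  have m01 : r 0 ≤ r 1 := hr (by decide)
  have m12 : r 1 ≤ r 2 := hr (by decide)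
  have m23 : r 2 ≤ r 3 := hr (by decide)
  have hRL := R_le_L p r hu
  have hnn := nm_le_np p R0 hu
  have cR := countLt_nonneg r (p - u)
  have i1 := indic_le_one (2 * p - R0 ≤ u)
  have i2 := indic_nonneg (u ≤ R0 - 2 * p)
  have i3 := indic_le_one (u ≤ R0 - 2 * p)
  have hc : centre p u = 0 := indic_neg (by rintro (h | h) <;> omega)
  have f1 := fact_loop0 hr (le_trans m01 (le_trans m12 (le_trans m23 hl3))) u
  have f2 := fact_loop1 hr (le_trans m12 (le_trans m23 hl3)) u
  have f3 := fact_loopL hr 2 (le_trans m23 hl3) u; rw [e2] at f3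
  have f4 := fact_loopL hr 3 hl3 u; rw [e3] at f4
  unfold score delta at hsc
  rw [hc] at hsc
  unfold L R np nm at *
  omega

/-! ### the centre class on the two types with `s₀ = 3` -/

/-- a=0, λ=(2,1): two blocks lie below `p` (`ρ₂ < p`), so the centre class scores `≥ 5`. -/
theorem five_le_score_zero_l21 (hr : Monotone r) (h12 : r 1 + r 2 < 2 * p) (R0 : ℤ) : 5 ≤ score p R0 r 0 := by
  have e1 : (((1 : Fin 7) : ℕ) : ℤ) = 1 := by decide
  have m12 : r 1 ≤ r 2 := hr (by decide)
  have L2 := countLt_ge hr 1 (show r 1 < 0 + p by linarith)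
  rw [e1] at L2
  have i1 := indic_nonneg (2 * p - R0 ≤ 0)
  rw [score_zero_eq]
  unfold L np
  linarith

/-- a=2, λ=(1): `ρ₁ < p`, and either `ρ₂ < p` or the looped block `1` forces `R₀ ≥ 2p` (`n₊(0) = 1`): the centre class scores `≥ 5`. -/
theorem five_le_score_zero_a2l1 (hr : Monotone r) (hl1 : r 1 ≤ R0 - p) (h01 : r 0 + r 1 < 2 * p) :
    5 ≤ score p R0 r 0 := by
  have e0 : (((0 : Fin 7) : ℕ) : ℤ) = 0 := by decide
  have e1 : (((1 : Fin 7) : ℕ) : ℤ) = 1 := by decide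
  have m01 : r 0 ≤ r 1 := hr (by decide)
  have L1 := countLt_ge hr 0 (show r 0 < 0 + p by linarith)
  rw [e0] at L1
  have i1 := indic_nonneg (2 * p - R0 ≤ 0)
  rw [score_zero_eq]
  by_cases h : r 1 < 0 + p
  · have L2 := countLt_ge hr 1 h
    rw [e1] at L2
    unfold L np
    linarith
  · have hn : indic (2 * p - R0 ≤ 0) = 1 := indic_pos (by linarith)
    unfold L np
    rw [hn]
    linarith

end RootTypes

end Summit.KontsevichZagierPeriods.Zeta5Search.DenomLaw.ThresholdModel.Rho
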